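import Mathlib.RingTheory.LocalRing.MaximalIdeal.Basic
import Mathlib.RingTheory.MvPolynomial.Homogeneous
import Mathlib.RingTheory.MvPolynomial.Ideal
import Mathlib.RingTheory.Ideal.Maps
import Mathlib.Algebra.CharP.Two
import Mathlib.Algebra.CharP.Lemmas
import Mathlib.Algebra.CharP.Algebra
import Mathlib.Algebra.Ring.GeomSum
import Summits.ResolutionOfSingularities.ResolutionOfSingularities.Theorems.FrobeniusClosingSteerConeSquareModPow
import HarnessLib

/-!
# Steer σ-residual — hNT4 STAGE 2, the LOCAL → POLYNOMIAL reduction (res-D-pv-004's (R1)/(R2)[/(R3)] for the chart identification T1)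

OURS (campaign res-hironaka, rung L ★L-G4, slot W4.1, crux `Steer` stmt-ResolutionOfSingularities-16345; res-L0-w41-plan-1 RULING 120c
«026 = blueprint §1 support for pv-004's STAGE 2: the local → polynomial reduction»; signatures = res-D-pv-004 AS res-L0-w41-stub-10
`Sig026-LocalPolynomialReduction.lean` 54377c8b59224515 (12:32:28Z), VERBATIM; blueprint `L/res-L0-w41-idea-3/HNT4-BLUEPRINT.md` §1 rows
T1/T2, §3). Pure commutative algebra, Mathlib only, Theses-free, definition-free; AI-produced, weaker than expert review; nothing here
is a statement of the manuscript under review.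

SETTING. `φ : A →+* B` injective into a LOCAL ring `B` which is «the localisation of `A` at the maximal ideal `𝔭 := φ⁻¹ 𝔪_B`» in the
hypothesis form `hfrac : ∀ z : B, ∃ a b : A, b ∉ 𝔭 ∧ z * φ b = φ a` (in the application `A = κ_m[T₁, T₂, T₃]`, `B = S(m+1) ⧸ (x m)`,
`𝔭 = (T)`).
* `maximalIdeal_eq_map_comap` — `𝔪_B = 𝔭·B`; `exists_denominator_of_mem_map_pow` — every element of `𝔭^N·B` is a fraction with
  numerator in `𝔭^N` and denominator outside `𝔭`.
* **(R1) `mem_pow_comap_of_map_mem_pow`** — `φ c ∈ 𝔪_B^N ⇒ c ∈ 𝔭^N` (clear denominators with `hφ`; `𝔭` maximal ⇒ a denominator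
  outside `𝔭` is invertible modulo `𝔭^N`, Mathlib `Ideal.IsMaximal.exists_inv_pow`).
* **(R2) `exists_sub_map_mem_pow`** — a fraction `z = φ a / φ b` is a «polynomial» modulo `𝔪_B^e`: `∃ h, z − φ h ∈ 𝔪_B^e` (truncated
  geometric series for `b⁻¹`: `b b′ = 1 + ν`, `h := a b′ Σ_{i<e} (−ν)^i`, `(1+ν)·Σ_{i<e}(−ν)^i = 1 − (−ν)^e`).
* **(R3) `exists_eq_sq_add_isHomogeneous_of_map_sub_sq_mem_pow`** — T2 IN THE LOCAL RING: `φ : κ[X_0..X_{n-1}] → B` as above with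
  `φ⁻¹ 𝔪_B = (X)`, `deg C ≤ 2e`, `φ C − z² ∈ 𝔪_B^(2e)` ⇒ `C = q² + C_{2e}` (R2: `z ≡ φ h`; char 2: `(z − φ h)² = z² − φ h²`; R1; then
  res-L0-w41-idea-3's SQ1 `ConeSquare.exists_eq_sq_add_isHomogeneous_of_sub_sq_mem_pow`, p-id of `…ConeSquareModPow.lean`).
-/

noncomputable section

-- single-problem summit: the doubled namespace component `ResolutionOfSingularities` is forced
set_option linter.dupNamespace false

namespace Summit.ResolutionOfSingularities.ResolutionOfSingularities.Theorems.SwitchingDichotomy.ConstOrder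

open IsLocalRing MvPolynomial

section Local

variable {A B : Type*} [CommRing A] [CommRing B] [IsLocalRing B] (φ : A →+* B)

/-- A denominator outside `𝔭 = φ⁻¹ 𝔪_B` maps to a unit of the local ring `B`. [folklore] -/
theorem isUnit_map_of_notMem_comap {b : A} (hb : b ∉ (maximalIdeal B).comap φ) : IsUnit (φ b) := by
  rw [Ideal.mem_comap] at hb
  exact IsLocalRing.notMem_maximalIdeal.mp hb

/-- **`𝔪_B = 𝔭·B`** when every element of `B` is a fraction `φ a / φ b` with `b ∉ 𝔭 = φ⁻¹ 𝔪_B`. [folklore] -/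
theorem maximalIdeal_eq_map_comap (hfrac : ∀ z : B, ∃ a b : A, b ∉ (maximalIdeal B).comap φ ∧ z * φ b = φ a) :
    maximalIdeal B = ((maximalIdeal B).comap φ).map φ := by
  refine le_antisymm (fun z hz => ?_) Ideal.map_comap_le
  obtain ⟨a, b, hb, hzb⟩ := hfrac z
  have hu : IsUnit (φ b) := isUnit_map_of_notMem_comap φ hb
  have ha : a ∈ (maximalIdeal B).comap φ := by
    rw [Ideal.mem_comap, ← hzb]
    exact Ideal.mul_mem_right _ _ hz
  have hz' : z = φ a * ↑hu.unit⁻¹ := by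
    rw [← hzb, mul_assoc, IsUnit.mul_val_inv, mul_one]
  rw [hz']
  exact Ideal.mul_mem_right _ _ (Ideal.mem_map_of_mem φ ha)

/-- **Clearing denominators in `𝔭^N·B`.** Every element `w ∈ (𝔭^N)·B` satisfies `w · φ s = φ a` for some `s ∉ 𝔭` and `a ∈ 𝔭^N`.
[folklore] -/
theorem exists_denominator_of_mem_map_pow
    (hfrac : ∀ z : B, ∃ a b : A, b ∉ (maximalIdeal B).comap φ ∧ z * φ b = φ a) (N : ℕ) {w : B}
    (hw : w ∈ (((maximalIdeal B).comap φ) ^ N).map φ) :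
    ∃ s a : A, s ∉ (maximalIdeal B).comap φ ∧ a ∈ ((maximalIdeal B).comap φ) ^ N ∧ w * φ s = φ a := by
  set 𝔭 := (maximalIdeal B).comap φ with h𝔭def
  haveI : 𝔭.IsPrime := Ideal.IsPrime.comap φ
  induction hw using Submodule.span_induction with
  | mem w hw =>
    obtain ⟨a, ha, rfl⟩ := hw
    exact ⟨1, a, fun h1 => Ideal.IsPrime.ne_top inferInstance ((Ideal.eq_top_iff_one _).mpr h1), ha, by
      rw [map_one, mul_one]⟩
  | zero => exact ⟨1, 0, fun h1 => Ideal.IsPrime.ne_top inferInstance ((Ideal.eq_top_iff_one _).mpr h1),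
      Ideal.zero_mem _, by rw [map_zero, zero_mul]⟩
  | add w₁ w₂ _ _ ih₁ ih₂ =>
    obtain ⟨s₁, a₁, hs₁, ha₁, h₁⟩ := ih₁
    obtain ⟨s₂, a₂, hs₂, ha₂, h₂⟩ := ih₂
    refine ⟨s₁ * s₂, a₁ * s₂ + a₂ * s₁, fun h => ?_, ?_, ?_⟩
    · rcases (Ideal.IsPrime.mem_or_mem inferInstance h) with h' | h'
      · exact hs₁ h'
      · exact hs₂ h'
    · exact add_mem (Ideal.mul_mem_right _ _ ha₁) (Ideal.mul_mem_right _ _ ha₂)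
    · rw [map_mul, map_add, map_mul, map_mul, add_mul, ← mul_assoc, h₁, mul_comm (φ s₁) (φ s₂), ← mul_assoc, h₂]
  | smul z w _ ih =>
    obtain ⟨s, a, hs, ha, h⟩ := ih
    obtain ⟨a', b', hb', hz⟩ := hfrac z
    refine ⟨b' * s, a' * a, fun h' => ?_, Ideal.mul_mem_left _ _ ha, ?_⟩
    · rcases (Ideal.IsPrime.mem_or_mem inferInstance h') with h'' | h''
      · exact hb' h''
      · exact hs h''
    · rw [smul_eq_mul, map_mul, map_mul, ← hz, ← h]
      ring

/-- **(R1) Contraction of powers of the maximal ideal** (res-D-pv-004's signature, verbatim): for `φ : A → B` injective into a local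
ring `B`, `𝔭 = φ⁻¹ 𝔪_B` maximal, and every element of `B` a fraction `φ a / φ b` with `b ∉ 𝔭`: `φ c ∈ 𝔪_B ^ N ⇒ c ∈ 𝔭 ^ N`
(`𝔪_B^N = 𝔭^N·B`; clear denominators; a denominator `s ∉ 𝔭` is invertible modulo `𝔭^N` since `𝔭` is maximal). [folklore] -/
theorem mem_pow_comap_of_map_mem_pow (hφ : Function.Injective φ) (h𝔭 : ((maximalIdeal B).comap φ).IsMaximal)
    (hfrac : ∀ z : B, ∃ a b : A, b ∉ (maximalIdeal B).comap φ ∧ z * φ b = φ a)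
    (N : ℕ) (c : A) (hc : φ c ∈ maximalIdeal B ^ N) : c ∈ (maximalIdeal B).comap φ ^ N := by
  set 𝔭 := (maximalIdeal B).comap φ with h𝔭def
  -- `𝔪_B^N = (𝔭^N)·B`
  have hpow : maximalIdeal B ^ N = (𝔭 ^ N).map φ := by
    rw [Ideal.map_pow, ← maximalIdeal_eq_map_comap φ hfrac]
  rw [hpow] at hc
  obtain ⟨s, a, hs, ha, h⟩ := exists_denominator_of_mem_map_pow φ hfrac N hc
  -- `c·s = a ∈ 𝔭^N`
  have hcs : c * s ∈ 𝔭 ^ N := by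
    have : φ (c * s) = φ a := by rw [map_mul, h]
    rw [hφ this]
    exact ha
  -- `s` is invertible modulo `𝔭^N`
  haveI := h𝔭
  obtain ⟨y, i, hi, hyi⟩ := Ideal.IsMaximal.exists_inv_pow 𝔭 hs N
  have : c = y * (c * s) + c * i := by
    calc c = c * (y * s + i) := by rw [hyi, mul_one]
      _ = y * (c * s) + c * i := by ring
  rw [this]
  exact add_mem (Ideal.mul_mem_left _ _ hcs) (Ideal.mul_mem_left _ _ hi)

/-- **(R2) Fractions are polynomials modulo `𝔪_B^e`** (res-D-pv-004's signature, verbatim): with `𝔭 = φ⁻¹ 𝔪_B` maximal, a fraction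
`z` with `z · φ b = φ a`, `b ∉ 𝔭`, satisfies `z − φ h ∈ 𝔪_B ^ e` for some `h : A` (`b b′ = 1 + ν` with `ν ∈ 𝔭` from the field `A/𝔭`;
`h := a·b′·Σ_{i<e} (−ν)^i`; `φ b · (z − φ h) = φ a · (−φ ν)^e`). [folklore] -/
theorem exists_sub_map_mem_pow (h𝔭 : ((maximalIdeal B).comap φ).IsMaximal) (z : B) (a b : A)
    (hb : b ∉ (maximalIdeal B).comap φ) (hz : z * φ b = φ a) (e : ℕ) :
    ∃ h : A, z - φ h ∈ maximalIdeal B ^ e := by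
  set 𝔭 := (maximalIdeal B).comap φ with h𝔭def
  obtain ⟨b', i, hi, hbi⟩ := Ideal.IsMaximal.exists_inv h𝔭 hb
  -- `b' * b = 1 - i`, `i ∈ 𝔭`; put `ν := -i`, so `b * b' = 1 + ν`
  set ν : A := -i with hν
  have hbb : b * b' = 1 + ν := by
    rw [hν, mul_comm, ← hbi]
    ring
  have hνm : φ ν ∈ maximalIdeal B := by
    rw [hν, map_neg]
    exact neg_mem (Ideal.mem_comap.mp hi)
  refine ⟨a * b' * ∑ k ∈ Finset.range e, (-ν) ^ k, ?_⟩
  have hu : IsUnit (φ b) := isUnit_map_of_notMem_comap φ hb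
  -- `φ b · (z − φ h) = φ a · (−φ ν)^e`
  have hgeom : (1 + ν) * ∑ k ∈ Finset.range e, (-ν) ^ k = 1 - (-ν) ^ e := by
    have := mul_neg_geom_sum (-ν) e
    rwa [sub_neg_eq_add] at this
  have hφS : φ ((1 + ν) * ∑ k ∈ Finset.range e, (-ν) ^ k) = 1 - (-φ ν) ^ e := by
    rw [hgeom, map_sub, map_one, map_pow, map_neg]
  have h1 : φ b * φ (a * b' * ∑ k ∈ Finset.range e, (-ν) ^ k) =
      φ a * φ ((1 + ν) * ∑ k ∈ Finset.range e, (-ν) ^ k) := by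
    rw [← hbb]
    simp only [map_mul]
    ring
  have key : φ b * (z - φ (a * b' * ∑ k ∈ Finset.range e, (-ν) ^ k)) = φ a * (-φ ν) ^ e := by
    calc φ b * (z - φ (a * b' * ∑ k ∈ Finset.range e, (-ν) ^ k))
        = z * φ b - φ b * φ (a * b' * ∑ k ∈ Finset.range e, (-ν) ^ k) := by ring
      _ = φ a - φ a * φ ((1 + ν) * ∑ k ∈ Finset.range e, (-ν) ^ k) := by rw [hz, h1]
      _ = φ a * (-φ ν) ^ e := by rw [hφS]; ring
  have hmem : φ b * (z - φ (a * b' * ∑ k ∈ Finset.range e, (-ν) ^ k)) ∈ maximalIdeal B ^ e := by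
    rw [key]
    exact Ideal.mul_mem_left _ _ (Ideal.pow_mem_pow (neg_mem hνm) e)
  have : z - φ (a * b' * ∑ k ∈ Finset.range e, (-ν) ^ k) =
      ↑hu.unit⁻¹ * (φ b * (z - φ (a * b' * ∑ k ∈ Finset.range e, (-ν) ^ k))) := by
    rw [← mul_assoc, IsUnit.val_inv_mul, one_mul]
  rw [this]
  exact Ideal.mul_mem_left _ _ hmem

end Local

/-! ## The polynomial case: `𝔭 = (X_0, …, X_{n−1})` is maximal -/

/-- `(X_i : i) = ker (constantCoeff)` in `MvPolynomial σ κ`. [folklore] -/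
theorem span_range_X_eq_ker_constantCoeff {σ κ : Type*} [CommRing κ] :
    Ideal.span (Set.range (X : σ → MvPolynomial σ κ)) = RingHom.ker (constantCoeff : MvPolynomial σ κ →+* κ) := by
  refine le_antisymm ?_ fun p hp => ?_
  · rw [Ideal.span_le]
    rintro _ ⟨i, rfl⟩
    simp [RingHom.mem_ker, constantCoeff_X]
  · rw [RingHom.mem_ker] at hp
    rw [← Set.image_univ, mem_ideal_span_X_image]
    intro m hm
    by_contra h
    push Not at h
    have hm0 : m = 0 := Finsupp.ext fun i => by simpa using h i (Set.mem_univ i)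
    subst hm0
    exact (mem_support_iff.mp hm) hp

/-- `(X_i : i)` is a MAXIMAL ideal of `MvPolynomial σ κ` over a field. [folklore] -/
theorem isMaximal_span_range_X {σ κ : Type*} [Field κ] :
    (Ideal.span (Set.range (X : σ → MvPolynomial σ κ))).IsMaximal := by
  rw [span_range_X_eq_ker_constantCoeff]
  exact RingHom.ker_isMaximal_of_surjective _ fun a => ⟨C a, constantCoeff_C _ a⟩

/-! ## (R3) T2 in the local ring -/

/-- **(R3) T2 in the local ring** (res-D-pv-004's signature, verbatim): `φ : κ[X_0, …, X_{n−1}] → B` injective into a local ring of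
characteristic `2` with `φ⁻¹ 𝔪_B = (X_0, …, X_{n−1})` and every element of `B` a fraction; if `deg C ≤ 2e` and `φ C − z² ∈ 𝔪_B^(2e)` for
some `z ∈ B`, then `C = q² + C_{2e}` with `C_{2e}` a `2e`-form and `q` supported in degrees `< e`. (R2 replaces `z` by a polynomial
`φ h` modulo `𝔪_B^e`; in characteristic `2` `(z − φ h)² = z² − φ h²`, so `φ (C − h²) ∈ 𝔪_B^(2e)`; R1 contracts; idea-3's SQ1 splits.)
[folklore] -/
theorem exists_eq_sq_add_isHomogeneous_of_map_sub_sq_mem_pow {κ B : Type*} [Field κ] [CommRing B]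
    [IsLocalRing B] [CharP B 2] {n : ℕ} (φ : MvPolynomial (Fin n) κ →+* B) (hφ : Function.Injective φ)
    (h𝔭 : (maximalIdeal B).comap φ = Ideal.span (Set.range X))
    (hfrac : ∀ z : B, ∃ a b : MvPolynomial (Fin n) κ, b ∉ (maximalIdeal B).comap φ ∧ z * φ b = φ a)
    (e : ℕ) (C : MvPolynomial (Fin n) κ) (hdeg : C.totalDegree ≤ 2 * e) (z : B)
    (hC : φ C - z ^ 2 ∈ maximalIdeal B ^ (2 * e)) :
    ∃ q Cd : MvPolynomial (Fin n) κ, C = q ^ 2 + Cd ∧ Cd.IsHomogeneous (2 * e) ∧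
      ∀ m ∈ q.support, m.degree < e := by
  haveI : Fact (Nat.Prime 2) := ⟨Nat.prime_two⟩
  -- `κ` has characteristic `2` too (`κ → κ[X] → B` is injective)
  haveI : CharP κ 2 :=
    (φ.comp (MvPolynomial.C : κ →+* MvPolynomial (Fin n) κ)).charP (hφ.comp (MvPolynomial.C_injective (Fin n) κ)) 2
  have h𝔭max : ((maximalIdeal B).comap φ).IsMaximal := by
    rw [h𝔭]
    exact isMaximal_span_range_X
  obtain ⟨a, b, hb, hz⟩ := hfrac z
  obtain ⟨h, hh⟩ := exists_sub_map_mem_pow φ h𝔭max z a b hb hz e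
  -- `φ (C − h²) = (φ C − z²) + (z − φ h)²` in characteristic `2`
  have hsq : (z - φ h) ^ 2 = z ^ 2 - φ h ^ 2 := sub_pow_char z (φ h)
  have hmem : φ (C - h ^ 2) ∈ maximalIdeal B ^ (2 * e) := by
    have hre : φ (C - h ^ 2) = (φ C - z ^ 2) + (z - φ h) ^ 2 := by
      rw [map_sub, map_pow, hsq]
      ring
    rw [hre]
    refine add_mem hC ?_
    have h2 := Ideal.pow_mem_pow hh 2
    rwa [← pow_mul, mul_comm] at h2
  have hpoly : C - h ^ 2 ∈ Ideal.span (Set.range (X : Fin n → MvPolynomial (Fin n) κ)) ^ (2 * e) := by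
    rw [← h𝔭]
    exact mem_pow_comap_of_map_mem_pow φ hφ h𝔭max hfrac (2 * e) (C - h ^ 2) hmem
  exact ConeSquare.exists_eq_sq_add_isHomogeneous_of_sub_sq_mem_pow e C h hdeg hpoly

end Summit.ResolutionOfSingularities.ResolutionOfSingularities.Theorems.SwitchingDichotomy.ConstOrder

end
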